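import Literature.NumberTheory.NumberFields.AmbiguousClassNumberFormula
import Literature.NumberTheory.NumberFields.RelativeNormPositivity
import HarnessLib

/-!
# Odd class numbers go UP a totally complex quadratic extension with one ramified finite prime over a base with
# one real place (Chevalley's ambiguous class number formula; genus theory)

Topic `NumberTheory/NumberFields`; namespace `Literature.NumberTheory.NumberFields.AmbiguousClass`. Theorem-only file
(no definition, no named fact, no `sorry`), written by the prover seat `bsd-2adic-k4-w2` GEN 9 (cell `bsd-2adic`; the
«GENUS-BRIDGE» for the sextic carriers `ℚ(β, √−1)` of K4's additive census; closes nothing there).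

For a cyclic extension `L/K` of number fields with group `G = ⟨σ⟩` the tree has Chevalley's formula
(`ambiguousClassNumberFormula`, Lang, *Cyclotomic Fields I–II*, Ch. 13 §4 Lemma 4.1):

  `#Cl(L)^G · [L : K] · [E_K : E_K ∩ N_{L/K} Lˣ] = h_K · ∏_𝔭 e_𝔭 · ∏_{v ∣ ∞} e_v`.

Here we evaluate it in the situation of genus theory for a QUADRATIC `L/K` with `L` TOTALLY COMPLEX:

* `archFactor_eq_two_pow_nrRealPlaces_of_isTotallyComplex` — `∏_{v ∣ ∞} e_v = 2^{r₁(K)}` (`L` totally complex, `L/K` Galois):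
  every real place of `K` lies under a complex place (ramified, `e_v = 2`), every complex place is unramified.
* `coe_herbrandNorm_eq_algebraMap_norm` — `N_G(y) = N_{L/K}(y)` as elements of `L`;
  `unitsIncl_neg_one_not_mem_map_norm` — if `K` has a real place, `−1 ∈ E_K` is NOT a norm from the totally complex `L`
  (norms are positive at every real place of `K`, tree `embedding_norm_pos_of_totallyPositive`); hence
  `two_dvd_relIndex_unitsNorm` — the unit index `[E_K : E_K ∩ N Lˣ]` is EVEN (the class of `−1` has order `2`).
* `odd_classNumber_of_odd_card_fixed` — for `Gal(L/K) = ⟨σ⟩` a `2`-group: if the number of ambiguous classes `#Cl(L)^G` is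
  odd then `h_L` is odd (fixed points of a `2`-power permutation, Mathlib `Equiv.Perm.card_fixedPoints_modEq`).
* **`odd_classNumber_of_quadratic_of_nrRealPlaces_eq_one`** — `[L : K] = 2`, `L` totally complex, `K` with EXACTLY ONE real
  place, `∏_𝔭 e_𝔭(L/K) = 2` (exactly one finite prime ramified) and `h_K` odd ⟹ `h_L` odd.
  Proof: Chevalley gives `#Cl(L)^G · 2 · [E_K : E_K ∩ N] = h_K · 2 · 2`; the index is even, say `2m`, so
  `#Cl(L)^G · m · 2 = 2 h_K`, `#Cl(L)^G · m = h_K` is odd, `#Cl(L)^G` is odd, and then `h_L` is odd.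

The intended consumer: `K = ℚ(β)` a complex cubic field (one real place) with one prime above `2` and odd class number,
`L = K(√−1)`: then `h_L` is odd, so (with one prime above `2` in `L`) Iwasawa's `μ₂` vanishes for every `ℤ₂`-extension of
`L` (Iwasawa 1956) — the input of the kernel door for Coates–Sujatha's (A) at `2` on the sextic carrier (cell bsd-2adic,
cruxlead-19573-w2 p718233). The totally real base (three real places) needs the unit-signature hypothesis instead of the
automatic `−1` and is not treated here. `-- TODO(general form): r₁(K) arbitrary with [E_K : E_K⁺] = 2^{r₁(K)} (Horie 1994 Thm. 1 shape).`

## References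

* S. Lang, *Cyclotomic Fields I and II*, GTM 121 (1990), Ch. 13 §4, Lemma 4.1 (PDF pp. 203–204). [Lang1990]
* G. Gras, *Class Field Theory* (2003), II.6.2.3, IV.4 (genus theory). [Gras2003]
* K. Horie, *On CM-fields with the same maximal real subfield*, Acta Arith. 67 (1994), §1 Lemma 1. [Horie1994]
* K. Iwasawa, *A note on class numbers of algebraic number fields*, Abh. Math. Sem. Hamburg 20 (1956). [Iwasawa1956]
-/

noncomputable section

open NumberField NumberField.InfinitePlace IsDedekindDomain
open scoped nonZeroDivisors

namespace Literature.NumberTheory.NumberFields.AmbiguousClass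

open Literature.NumberTheory.GaloisRepresentations Literature.NumberTheory.GaloisRepresentations.Herbrand
  Literature.NumberTheory.GaloisRepresentations.MinkowskiUnit
  Literature.NumberTheory.GaloisRepresentations.CyclicNormIndex

variable {K L : Type} [Field K] [NumberField K] [Field L] [NumberField L] [Algebra K L]

/-! ### The archimedean factor for a totally complex top field -/

omit [NumberField L] in
/-- **`∏_{v ∣ ∞} e_v = 2^{r₁(K)}` when `L` is totally complex** (`L/K` Galois): a real place of `K` lies under a complex place
of `L` (ramified, decomposition group of order `2`), a complex place of `K` is unramified (order `1`).
[cite: Lang1990, Ch. 13 §4, before Lemma 4.1 ("if `v` is Archimedean, then `e(v) = 1` or `2`") (PDF p. 203)] -/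
theorem archFactor_eq_two_pow_nrRealPlaces_of_isTotallyComplex [IsGalois K L] [IsTotallyComplex L] :
    ArchHerbrand.archFactor K L = 2 ^ nrRealPlaces K := by
  classical
  unfold ArchHerbrand.archFactor
  have hv : ∀ v : InfinitePlace K, Nat.card (MulAction.stabilizer (L ≃ₐ[K] L) (ArchHerbrand.placeOver L v)) =
      if v.IsReal then 2 else 1 := by
    intro v
    have hover : (ArchHerbrand.placeOver L v).comap (algebraMap K L) = v := ArchHerbrand.isOver_placeOver v
    by_cases h : v.IsReal
    · rw [if_pos h, ← not_isUnramified_iff_card_stabilizer_eq_two, not_isUnramified_iff, hover]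
      exact ⟨IsTotallyComplex.isComplex _, h⟩
    · rw [if_neg h, ← isUnramified_iff_card_stabilizer_eq_one, isUnramified_iff, hover]
      exact Or.inr (not_isReal_iff_isComplex.mp h)
  simp_rw [hv]
  rw [Finset.prod_ite, Finset.prod_const, Finset.prod_const, one_pow, mul_one]
  congr 1
  rw [nrRealPlaces, Fintype.card_subtype]

/-! ### Norms from a totally complex field are positive at the real places of the base -/

/-- `N_G = N_{L/K}` on `Lˣ` (values): `(N_G y : L) = ∏_{τ ∈ G} τ y = N_{L/K}(y)` for `Gal(L/K) = ⟨σ⟩` (the norm of a Galois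
extension is the product of the conjugates). [cite: NeukirchANT1999, Ch. IV §7 (p. 310)] [cite: Lang1990, Ch. 13 §4 (PDF p. 203)] -/
theorem coe_herbrandNorm_eq_algebraMap_norm [IsGalois K L] {σ : L ≃ₐ[K] L}
    (hσ : ∀ τ : L ≃ₐ[K] L, τ ∈ Subgroup.zpowers σ) (y : Lˣ) :
    ((Herbrand.norm (L ≃ₐ[K] L) y : Lˣ) : L) = algebraMap K L (Algebra.norm K (y : L)) := by
  rw [← coe_normEnd_eq_algebraMap_norm hσ, normEnd_apply,
    prod_range_card_pow_eq_prod hσ (fun g => g • y), ← norm_apply]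

/-- **`−1` is not a norm from a totally complex `L` to a `K` with a real place**: under a real embedding `ρ` of `K`,
`ρ(N_{L/K} y) > 0` (tree `embedding_norm_pos_of_totallyPositive`; `L` has no real embedding, so the positivity hypothesis
is empty) while `ρ(−1) = −1`. [cite: Lang1990, Ch. 13 §4, Lemma 4.1 (the index `(E_F : N_{K/F}K^* ∩ E_F)`) (PDF p. 203)]
[cite: Gras2003, II.6.2.3] -/
theorem unitsIncl_neg_one_not_mem_map_norm [IsGalois K L] [IsTotallyComplex L] {σ : L ≃ₐ[K] L}
    (hσ : ∀ τ : L ≃ₐ[K] L, τ ∈ Subgroup.zpowers σ) (ρ : K →+* ℝ) :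
    unitsIncl K L (-1) ∉ (⊤ : Subgroup Lˣ).map (Herbrand.norm (L ≃ₐ[K] L)) := by
  rintro ⟨y, -, hy⟩
  have hpos : 0 < ρ (Algebra.norm K (y : L)) := by
    refine embedding_norm_pos_of_totallyPositive (Units.ne_zero y) (fun τ => ?_) ρ
    -- `L` is totally complex: a real embedding `τ` would give a real place
    exfalso
    have hφ : ComplexEmbedding.IsReal (Complex.ofRealHom.comp τ) := by
      rw [ComplexEmbedding.isReal_iff]
      ext x
      simp [ComplexEmbedding.conjugate_coe_eq]
    have hw : (InfinitePlace.mk (Complex.ofRealHom.comp τ)).IsReal := ⟨_, hφ, rfl⟩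
    exact (not_isReal_iff_isComplex.mpr (IsTotallyComplex.isComplex _)) hw
  have h2 : algebraMap K L (Algebra.norm K (y : L)) = algebraMap K L (-1) := by
    rw [← coe_herbrandNorm_eq_algebraMap_norm hσ, hy, coe_unitsIncl, Units.val_neg, Units.val_one]
  have h3 := (algebraMap K L).injective h2
  rw [h3, map_neg, map_one] at hpos
  linarith

/-- `−1 ∈ E_K = 𝓞_Lˣ ∩ Kˣ` (inside `Lˣ`). [folklore] -/
private theorem unitsIncl_neg_one_mem_unitsE_inf_range :
    unitsIncl K L (-1) ∈ unitsE L ⊓ (unitsIncl K L).range := by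
  refine ⟨mem_unitsE_iff.mpr ⟨-1, ?_⟩, ⟨-1, rfl⟩⟩
  ext
  rw [Units.coe_map, MonoidHom.coe_coe, Units.val_neg, Units.val_one, map_neg, map_one, coe_unitsIncl,
    Units.val_neg, Units.val_one, map_neg, map_one]

/-- **The unit index of Chevalley's formula is EVEN** when `L` is totally complex and `K` has a real place: the class of
`−1 ∈ E_K` in `E_K / (E_K ∩ N_{L/K} Lˣ)` has order exactly `2` (`−1` is not a norm, `(−1)² = 1`).
[cite: Lang1990, Ch. 13 §4, Lemma 4.1 (PDF p. 203)] [cite: Gras2003, II.6.2.3] -/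
theorem two_dvd_relIndex_unitsNorm [IsGalois K L] [IsTotallyComplex L] {σ : L ≃ₐ[K] L}
    (hσ : ∀ τ : L ≃ₐ[K] L, τ ∈ Subgroup.zpowers σ) (ρ : K →+* ℝ) :
    2 ∣ (unitsE L ⊓ (⊤ : Subgroup Lˣ).map (Herbrand.norm (L ≃ₐ[K] L))).relIndex
        (unitsE L ⊓ (unitsIncl K L).range) := by
  set H := unitsE L ⊓ (⊤ : Subgroup Lˣ).map (Herbrand.norm (L ≃ₐ[K] L)) with hH
  set E := unitsE L ⊓ (unitsIncl K L).range with hE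
  have hx : unitsIncl K L (-1) ∈ E := unitsIncl_neg_one_mem_unitsE_inf_range
  have hxH : (⟨unitsIncl K L (-1), hx⟩ : E) ∉ H.subgroupOf E := by
    rw [Subgroup.mem_subgroupOf]
    exact fun h => unitsIncl_neg_one_not_mem_map_norm hσ ρ h.2
  rw [Subgroup.relIndex, Subgroup.index]
  set q : E ⧸ H.subgroupOf E := QuotientGroup.mk ⟨unitsIncl K L (-1), hx⟩ with hq
  have hq1 : q ≠ 1 := fun h => hxH ((QuotientGroup.eq_one_iff _).mp h)
  have hq2 : q ^ 2 = 1 := by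
    rw [hq, ← QuotientGroup.mk_pow, QuotientGroup.eq_one_iff]
    have : (⟨unitsIncl K L (-1), hx⟩ : E) ^ 2 = 1 := by
      ext
      simp only [SubmonoidClass.mk_pow, Subgroup.coe_one, ← map_pow, neg_one_sq, map_one]
    rw [this]
    exact Subgroup.one_mem _
  have hord : orderOf q = 2 := orderOf_eq_prime hq2 hq1
  rw [← hord]
  exact orderOf_dvd_natCard q

/-! ### Ambiguous classes odd ⟹ class number odd -/

/-- **If `Gal(L/K) = ⟨σ⟩` is a `2`-group and the number of ambiguous classes `#Cl(L)^G` is odd, then `h_L` is odd**: the classes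
fixed by `G` are the fixed points of the permutation `c ↦ σ c` of `Cl(L)`, whose order divides `#G = 2^n`, and a `2`-power
permutation of a finite set fixes a number of points congruent to the size of the set mod `2`.
[cite: Lang1990, Ch. 13 §4, Lemma 4.2 and its proof (the `ℓ`-group acting on the class group) (PDF p. 204)] -/
theorem odd_classNumber_of_odd_card_fixed {σ : L ≃ₐ[K] L} (hσ : ∀ τ : L ≃ₐ[K] L, τ ∈ Subgroup.zpowers σ)
    {n : ℕ} (hn : σ ^ 2 ^ n = 1)
    (hodd : Odd (Nat.card {c : ClassGroup (𝓞 L) // ∀ τ : L ≃ₐ[K] L, ClassGroup.mulEquiv (intAut τ) c = c})) :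
    Odd (classNumber L) := by
  classical
  haveI : Fact (Nat.Prime 2) := ⟨Nat.prime_two⟩
  set f : Function.End (ClassGroup (𝓞 L)) := ⇑(ClassGroup.mulEquiv (intAut σ)) with hf
  -- powers of `f` are the actions of the powers of `σ`
  have hpow : ∀ (k : ℕ) (c : ClassGroup (𝓞 L)), (f ^ k) c = ClassGroup.mulEquiv (intAut (σ ^ k)) c := by
    intro k
    induction k with
    | zero => intro c; rw [pow_zero, pow_zero, mulEquiv_intAut_one]; rfl
    | succ k ih =>
      intro c
      rw [pow_succ, pow_succ, mulEquiv_intAut_mul, MulEquiv.trans_apply, ← ih]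
      rfl
  have hfn : f ^ 2 ^ n = 1 := by
    funext c
    rw [hpow, hn, mulEquiv_intAut_one]
    rfl
  have hmod := Equiv.Perm.card_fixedPoints_modEq (p := 2) hfn
  -- the fixed points of `f` are exactly the ambiguous classes
  have hfix : ∀ c : ClassGroup (𝓞 L), c ∈ Function.fixedPoints f ↔
      ∀ τ : L ≃ₐ[K] L, ClassGroup.mulEquiv (intAut τ) c = c := by
    intro c
    constructor
    · intro hc τ
      obtain ⟨k, rfl⟩ := (Submonoid.mem_powers_iff _ _).mp ((mem_powers_iff_mem_zpowers).mpr (hσ τ))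
      rw [← hpow]
      clear hmod
      induction k with
      | zero => rfl
      | succ k ih => rw [pow_succ, Function.End.mul_def, Function.comp_apply, hc.eq, ih]
    · intro hc
      exact hc σ
  have hcard : Fintype.card (Function.fixedPoints f) =
      Nat.card {c : ClassGroup (𝓞 L) // ∀ τ : L ≃ₐ[K] L, ClassGroup.mulEquiv (intAut τ) c = c} := by
    rw [← Nat.card_eq_fintype_card]
    exact Nat.card_congr (Equiv.subtypeEquivRight hfix)
  rw [classNumber, Nat.odd_iff, hmod, ← Nat.odd_iff, hcard]
  exact hodd

/-! ### The parity transfer -/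

/-- **Odd class numbers go up a totally complex quadratic extension with one ramified finite prime over a base with exactly one
real place.** `L/K` quadratic (Galois, `Gal = ⟨σ⟩`, `[L : K] = 2`), `L` totally complex, `K` with exactly one real place,
`∏_𝔭 e_𝔭(L/K) = 2` (one finite prime of `K` ramified in `L`, necessarily with `e = 2`) and `h_K` odd ⟹ `h_L` odd. Chevalley's
formula reads `#Cl(L)^G · 2 · [E_K : E_K ∩ N] = h_K · 2 · 2`; the index is even (`two_dvd_relIndex_unitsNorm`), so
`#Cl(L)^G` divides `h_K`, hence is odd, and `odd_classNumber_of_odd_card_fixed` concludes. (Genus theory: the two ramified places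
— the finite one and the real one — are exactly compensated by the non-norm unit `−1`.)
[cite: Lang1990, Ch. 13 §4, Lemma 4.1 (PDF pp. 203–204)] [cite: Gras2003, IV.4 (genus theory)] [cite: Horie1994, §1 Lemma 1] -/
theorem odd_classNumber_of_quadratic_of_nrRealPlaces_eq_one [IsGalois K L] [IsTotallyComplex L] {σ : L ≃ₐ[K] L}
    (hσ : ∀ τ : L ≃ₐ[K] L, τ ∈ Subgroup.zpowers σ) (h2 : Module.finrank K L = 2) (hreal : nrRealPlaces K = 1)
    (hram : ∏ᶠ v : HeightOneSpectrum (𝓞 K), v.asIdeal.ramificationIdxIn (𝓞 L) = 2)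
    (hK : Odd (classNumber K)) : Odd (classNumber L) := by
  classical
  -- a real embedding of `K`
  obtain ⟨w₀, hw₀⟩ : ∃ w : InfinitePlace K, w.IsReal := by
    by_contra h
    push Not at h
    have : nrRealPlaces K = 0 := by
      rw [nrRealPlaces, Fintype.card_eq_zero_iff]
      exact ⟨fun w => h w.1 w.2⟩
    omega
  let ρ : K →+* ℝ := InfinitePlace.embedding_of_isReal hw₀
  -- Chevalley
  have hChev := ambiguousClassNumberFormula hσ
  rw [h2, hram, archFactor_eq_two_pow_nrRealPlaces_of_isTotallyComplex, hreal, pow_one] at hChev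
  obtain ⟨m, hm⟩ := two_dvd_relIndex_unitsNorm hσ ρ
  rw [hm] at hChev
  -- `#Cl(L)^G · m = h_K`
  have hA : Nat.card {c : ClassGroup (𝓞 L) // ∀ τ : L ≃ₐ[K] L, ClassGroup.mulEquiv (intAut τ) c = c} * m =
      classNumber K := by
    have h4 : Nat.card {c : ClassGroup (𝓞 L) // ∀ τ : L ≃ₐ[K] L, ClassGroup.mulEquiv (intAut τ) c = c} * m * 4 =
        classNumber K * 4 := by
      calc _ = Nat.card {c : ClassGroup (𝓞 L) // ∀ τ : L ≃ₐ[K] L, ClassGroup.mulEquiv (intAut τ) c = c} * 2 * (2 * m) := by ring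
        _ = classNumber K * 2 * 2 := hChev
        _ = classNumber K * 4 := by ring
    exact Nat.eq_of_mul_eq_mul_right (by norm_num) h4
  have hAodd : Odd (Nat.card {c : ClassGroup (𝓞 L) // ∀ τ : L ≃ₐ[K] L, ClassGroup.mulEquiv (intAut τ) c = c}) := by
    rw [← hA] at hK
    exact (Nat.odd_mul.mp hK).1
  -- `σ² = 1`
  have hσ2 : σ ^ 2 ^ 1 = 1 := by
    have hc : Fintype.card (L ≃ₐ[K] L) = 2 := by
      rw [← Nat.card_eq_fintype_card, IsGalois.card_aut_eq_finrank, h2]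
    rw [pow_one, ← hc]
    exact pow_card_eq_one
  exact odd_classNumber_of_odd_card_fixed hσ hσ2 hAodd

end Literature.NumberTheory.NumberFields.AmbiguousClass

end
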